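import Mathlib

/-!
# BSD rank-≤1 residual cell, class X11b @ 3 — the UNIT / S-UNIT `p`-SATURATION step of the analytic-road certificate ((C2), (C3a))

HONEST FRAMING (cell `b2b-bsdres-*`): this file books NOTHING; it is the elementary algebra behind two lines of every
analytic-road record (x9 route 2, X9-CENSUS-G32 §2; x11b GEN 13/14, `HOME/b2b-bsdres-x11b/g13/ANALYTIC-ROAD.md` §1 (C2)–(C3)):
* (C2) **unit `p`-saturation ⇒ `p ∤ k`.** `M = Additive (𝓞_A)ˣ`, `T` = its (finite) torsion subgroup `μ(A)` with `p ∤ #μ(A)`,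
  `u₁ … uₙ` = the computed (GRH) fundamental units, `H = T ⊔ ⟨u₁,…,uₙ⟩` of finite index `k` (the UNIT INDEX, `R~ = k·R`),
  `χ₁ … χₘ : M →+ ZMod p` = `p`-th power residue characters at auxiliary primes. If the `m × n` matrix `(χᵢ(uⱼ))` has full
  column rank over `𝔽_p` (`hind`; a concrete certificate is an invertible `n × n` minor, `charIndep_of_mul_eq_one`), then `H` is
  `p`-saturated in `M` (`nsmul_mem_imp_mem_of_charMatrix`) and `p ∤ k` (`not_dvd_index_of_charMatrix`) — the hypothesis `p ∤ k` of
  `X11b/AnalyticClassNumberCriterion.padicValNat_classNumber_eq` (`h = k·h~ ⇒ v_p(h) = v_p(h~)`).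
* (C3a) **generation modulo `p`-th powers.** `M = Additive` of the `S`-unit group, `P ⊆ p•M`, `#(M ⧸ P) ≤ p ^ n` (Dirichlet's
  `S`-unit theorem: `n = r₁ + r₂ − 1 + #S_A` when `p ∤ #μ(A)`), `u₁ … uₙ` units and `S`-units with full character rank: then EVERY
  element of `M` is `∑ fⱼ•uⱼ + p•y` (`exists_eq_sum_add_nsmul_of_charMatrix`), i.e. the `uⱼ` span `U_S/U_S^p`, and in fact
  `#(M ⧸ P) = p ^ n` (`natCard_quotient_eq_of_charMatrix`, a consistency check the record can assert). Together with the S-class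
  step `X11b/SClassCertificate` (`Cl_S(A)[p] = 0`) this is the completeness of the descent space `A(S,p) = U_S/U_S^p`
  (the Kummer sequence `1 → U_S/U_S^p → A(S,p) → Cl_S(A)[p] → 1` is on paper, not here).
Pure algebra of abelian groups and `𝔽_p`-linear algebra; no number theory is formalised here. X11 ∧ r = 1 ∧ p = 3 stays
CONSTRUCTION-SHAPED (R6.2); not "finishing BSD".
-/

namespace Summit.BirchSwinnertonDyer.Rank1Residual.X11b.UnitSaturationCertificate

open Finset

variable {M : Type*} [AddCommGroup M] {p : ℕ} [hp : Fact p.Prime] {n m : ℕ}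

/-- A `ZMod p`-valued additive character kills every element of a finite subgroup of order prime to `p`
(for the records: `χ(−1) = 0` for a cubic residue character, `#μ(A) = 2`). -/
theorem char_eq_zero_of_mem_finite (T : AddSubgroup M) [Finite T] (hT : ¬ p ∣ Nat.card T) (χ : M →+ ZMod p)
    {t : M} (ht : t ∈ T) : χ t = 0 := by
  have h1 : Nat.card T • t = 0 := by
    have h : Nat.card T • (⟨t, ht⟩ : T) = 0 := card_nsmul_eq_zero'
    have := congrArg ((↑) : T → M) h
    simpa only [AddSubmonoidClass.coe_nsmul, ZeroMemClass.coe_zero] using this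
  have h2 : (Nat.card T : ZMod p) * χ t = 0 := by
    rw [← nsmul_eq_mul, ← map_nsmul, h1, map_zero]
  have hne : (Nat.card T : ZMod p) ≠ 0 := by
    rw [Ne, CharP.cast_eq_zero_iff (ZMod p) p]
    exact hT
  exact (mul_eq_zero.mp h2).resolve_left hne

/-- The `𝔽_p`-linear-algebra step: if every character vanishes on an integer combination `∑ cⱼ•uⱼ`, full column rank of the
character matrix forces `p ∣ cⱼ` for every `j`. -/
theorem dvd_coeff_of_chars_vanish (u : Fin n → M) (χ : Fin m → M →+ ZMod p)
    (hind : ∀ e : Fin n → ZMod p, (∀ i, ∑ j, e j * χ i (u j) = 0) → e = 0)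
    (c : Fin n → ℤ) (hc : ∀ i, χ i (∑ j, c j • u j) = 0) (j : Fin n) : (p : ℤ) ∣ c j := by
  have h := hind (fun j => (c j : ZMod p)) (fun i => by
    have := hc i
    simpa [map_sum, map_zsmul, zsmul_eq_mul] using this)
  have hj : ((c j : ℤ) : ZMod p) = 0 := congrFun h j
  exact (CharP.intCast_eq_zero_iff (ZMod p) p (c j)).mp hj

/-- A concrete rank certificate: an `n × n` minor of the character matrix (rows `rows k`) with an explicit left inverse `N`
over `ZMod p` gives full column rank (`hind`). -/
theorem charIndep_of_mul_eq_one (u : Fin n → M) (χ : Fin m → M →+ ZMod p) (rows : Fin n → Fin m)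
    (N : Matrix (Fin n) (Fin n) (ZMod p)) (hN : N * Matrix.of (fun k j => χ (rows k) (u j)) = 1) :
    ∀ e : Fin n → ZMod p, (∀ i, ∑ j, e j * χ i (u j) = 0) → e = 0 := by
  intro e he
  set A : Matrix (Fin n) (Fin n) (ZMod p) := Matrix.of (fun k j => χ (rows k) (u j)) with hA
  have hAe : A.mulVec e = 0 := by
    funext k
    simp only [Matrix.mulVec, dotProduct, hA, Matrix.of_apply, Pi.zero_apply]
    rw [← he (rows k)]
    exact Finset.sum_congr rfl (fun j _ => mul_comm _ _)
  calc e = (N * A).mulVec e := by rw [hN, Matrix.one_mulVec]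
    _ = N.mulVec (A.mulVec e) := by rw [Matrix.mulVec_mulVec]
    _ = 0 := by rw [hAe, Matrix.mulVec_zero]

/-- **(C2) saturation.** `T` finite with `p ∤ #T` and containing every element of finite order, `H = T ⊔ ⟨u₁,…,uₙ⟩`, characters
of full column rank on the `uⱼ`: then `p•g ∈ H ⇒ g ∈ H`. (Proof: `p•g = t + ∑ aⱼ•uⱼ`; the characters kill `t` and `p•g`, so
`p ∣ aⱼ`, `aⱼ = p·bⱼ`; `y := g − ∑ bⱼ•uⱼ` has `p•y = t`, hence finite order, hence `y ∈ T`, and `g = y + ∑ bⱼ•uⱼ ∈ H`.) -/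
theorem nsmul_mem_imp_mem_of_charMatrix (T : AddSubgroup M) [Finite T] (hT : ¬ p ∣ Nat.card T)
    (htors : ∀ g : M, IsOfFinAddOrder g → g ∈ T) (u : Fin n → M) (χ : Fin m → M →+ ZMod p)
    (hind : ∀ e : Fin n → ZMod p, (∀ i, ∑ j, e j * χ i (u j) = 0) → e = 0)
    {g : M} (hg : p • g ∈ T ⊔ AddSubgroup.closure (Set.range u)) : g ∈ T ⊔ AddSubgroup.closure (Set.range u) := by
  obtain ⟨t, ht, c, hc, htc⟩ := AddSubgroup.mem_sup.mp hg
  obtain ⟨a, rfl⟩ := AddSubgroup.mem_closure_range_iff_of_fintype.mp hc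
  -- the characters vanish on `∑ aⱼ•uⱼ = p•g − t`
  have hvan : ∀ i, χ i (∑ j, a j • u j) = 0 := by
    intro i
    have h1 : χ i t = 0 := char_eq_zero_of_mem_finite T hT (χ i) ht
    have h2 : χ i (p • g) = 0 := by
      rw [map_nsmul, nsmul_eq_mul, CharP.cast_eq_zero, zero_mul]
    have h3 : (∑ j, a j • u j) = p • g - t := by rw [← htc]; abel
    rw [h3, map_sub, h1, h2, sub_zero]
  have hdvd : ∀ j, (p : ℤ) ∣ a j := dvd_coeff_of_chars_vanish u χ hind a hvan
  choose b hb using hdvd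
  set y : M := g - ∑ j, b j • u j with hy
  have hpy : p • y = t := by
    have hsum : (p : ℤ) • (∑ j, b j • u j) = ∑ j, a j • u j := by
      rw [Finset.smul_sum]
      refine Finset.sum_congr rfl (fun j _ => ?_)
      rw [← mul_smul, ← hb j]
    have : (p : ℤ) • y = p • g - ∑ j, a j • u j := by
      rw [hy, smul_sub, hsum, natCast_zsmul]
    rw [← natCast_zsmul, this, ← htc]
    abel
  have hfin : IsOfFinAddOrder y := by
    rw [isOfFinAddOrder_iff_nsmul_eq_zero]
    haveI : Nonempty T := ⟨⟨0, T.zero_mem⟩⟩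
    refine ⟨Nat.card T * p, Nat.mul_pos Nat.card_pos hp.out.pos, ?_⟩
    rw [mul_smul, hpy]
    have h : Nat.card T • (⟨t, ht⟩ : T) = 0 := card_nsmul_eq_zero'
    have := congrArg ((↑) : T → M) h
    simpa only [AddSubmonoidClass.coe_nsmul, ZeroMemClass.coe_zero] using this
  have hyT : y ∈ T := htors y hfin
  have hg' : g = y + ∑ j, b j • u j := by rw [hy]; abel
  rw [hg']
  exact AddSubgroup.add_mem_sup hyT (AddSubgroup.mem_closure_range_iff_of_fintype.mpr ⟨b, rfl⟩)

/-- A `p`-saturated subgroup of finite index has index prime to `p` (Cauchy in the finite quotient). -/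
theorem not_dvd_index_of_saturated (H : AddSubgroup M) [H.FiniteIndex] (hsat : ∀ g : M, p • g ∈ H → g ∈ H) :
    ¬ p ∣ H.index := by
  intro hdvd
  rw [AddSubgroup.index_eq_card] at hdvd
  obtain ⟨x, hx⟩ := exists_prime_addOrderOf_dvd_card' p hdvd
  obtain ⟨g, rfl⟩ := QuotientAddGroup.mk_surjective x
  have hpg : p • g ∈ H := by
    rw [← QuotientAddGroup.eq_zero_iff, QuotientAddGroup.mk_nsmul, ← hx]
    exact addOrderOf_nsmul_eq_zero _
  have h0 : (QuotientAddGroup.mk g : M ⧸ H) = 0 := (QuotientAddGroup.eq_zero_iff g).mpr (hsat g hpg)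
  rw [h0, addOrderOf_zero] at hx
  exact absurd hx hp.out.one_lt.ne

/-- **(C2) the unit index is prime to `p`.** With `M = Additive (𝓞_A)ˣ`, `T = μ(A)`, `uⱼ` the computed units and `H = T ⊔ ⟨uⱼ⟩`
of finite index `k`: a full-column-rank `p`-th-power-residue character matrix gives `p ∤ k`. -/
theorem not_dvd_index_of_charMatrix (T : AddSubgroup M) [Finite T] (hT : ¬ p ∣ Nat.card T)
    (htors : ∀ g : M, IsOfFinAddOrder g → g ∈ T) (u : Fin n → M) (χ : Fin m → M →+ ZMod p)
    (hind : ∀ e : Fin n → ZMod p, (∀ i, ∑ j, e j * χ i (u j) = 0) → e = 0)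
    [(T ⊔ AddSubgroup.closure (Set.range u)).FiniteIndex] : ¬ p ∣ (T ⊔ AddSubgroup.closure (Set.range u)).index :=
  not_dvd_index_of_saturated _ (fun _ hg => nsmul_mem_imp_mem_of_charMatrix T hT htors u χ hind hg)

/-- Kernel of the comparison map for (C3a): if `∑ cⱼ•uⱼ ∈ P ⊆ p•M` then every `cⱼ ≡ 0 (mod p)`. -/
theorem coeff_cast_eq_zero_of_sum_mem (u : Fin n → M) (χ : Fin m → M →+ ZMod p)
    (hind : ∀ e : Fin n → ZMod p, (∀ i, ∑ j, e j * χ i (u j) = 0) → e = 0)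
    (P : AddSubgroup M) (hP : ∀ x ∈ P, ∃ y : M, x = p • y) (c : Fin n → ℤ) (hc : (∑ j, c j • u j) ∈ P) (j : Fin n) :
    (c j : ZMod p) = 0 := by
  obtain ⟨y, hy⟩ := hP _ hc
  have hvan : ∀ i, χ i (∑ j, c j • u j) = 0 := by
    intro i; rw [hy, map_nsmul, nsmul_eq_mul, CharP.cast_eq_zero, zero_mul]
  exact (CharP.intCast_eq_zero_iff (ZMod p) p (c j)).mpr (dvd_coeff_of_chars_vanish u χ hind c hvan j)

/-- The comparison map `e ↦ [∑ ẽⱼ•uⱼ] : (Fin n → ZMod p) → M ⧸ P` (with `ẽⱼ = (eⱼ).val`) is injective under `hind` when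
`P ⊆ p•M`. -/
theorem comparison_injective (u : Fin n → M) (χ : Fin m → M →+ ZMod p)
    (hind : ∀ e : Fin n → ZMod p, (∀ i, ∑ j, e j * χ i (u j) = 0) → e = 0)
    (P : AddSubgroup M) (hP : ∀ x ∈ P, ∃ y : M, x = p • y) :
    Function.Injective (fun e : Fin n → ZMod p => (QuotientAddGroup.mk (∑ j, (e j).val • u j) : M ⧸ P)) := by
  haveI : NeZero p := ⟨hp.out.ne_zero⟩
  intro e₁ e₂ h
  have h' : -(∑ j, (e₁ j).val • u j) + ∑ j, (e₂ j).val • u j ∈ P := QuotientAddGroup.eq.mp h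
  have hmem : (∑ j, (((e₂ j).val : ℤ) - (e₁ j).val) • u j) ∈ P := by
    have : (∑ j, (((e₂ j).val : ℤ) - (e₁ j).val) • u j) = -(∑ j, (e₁ j).val • u j) + ∑ j, (e₂ j).val • u j := by
      simp only [sub_smul, Finset.sum_sub_distrib, natCast_zsmul]
      abel
    rw [this]; exact h'
  funext j
  have h0 := coeff_cast_eq_zero_of_sum_mem u χ hind P hP _ hmem j
  rw [Int.cast_sub, Int.cast_natCast, Int.cast_natCast, ZMod.natCast_zmod_val, ZMod.natCast_zmod_val, sub_eq_zero] at h0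
  exact h0.symm

/-- **(C3a) generation modulo `p`-th powers.** `P ⊆ p•M` with `#(M ⧸ P) ≤ p ^ n` and `u₁ … uₙ` of full character rank: every
`g : M` is `∑ fⱼ•uⱼ + p•y`. (The comparison map from `𝔽_pⁿ` is injective, hence bijective by counting.) For the records:
`M = Additive` of the `S`-unit group of `A`, `P = 3•M`, `n = 4 + #S_A`, so the certified units and `S`-units span `U_S/U_S³`. -/
theorem exists_eq_sum_add_nsmul_of_charMatrix (u : Fin n → M) (χ : Fin m → M →+ ZMod p)
    (hind : ∀ e : Fin n → ZMod p, (∀ i, ∑ j, e j * χ i (u j) = 0) → e = 0)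
    (P : AddSubgroup M) (hP : ∀ x ∈ P, ∃ y : M, x = p • y) [Finite (M ⧸ P)] (hcard : Nat.card (M ⧸ P) ≤ p ^ n) (g : M) :
    ∃ f : Fin n → ℕ, ∃ y : M, g = ∑ j, f j • u j + p • y := by
  have hinj := comparison_injective u χ hind P hP
  have hcardF : Nat.card (Fin n → ZMod p) = p ^ n := by
    classical
    rw [Nat.card_eq_fintype_card, Fintype.card_fun, ZMod.card, Fintype.card_fin]
  have hbij := hinj.bijective_of_nat_card_le (by rw [hcardF]; exact hcard)
  obtain ⟨e, he⟩ := hbij.2 (QuotientAddGroup.mk g)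
  have hmem : -(∑ j, (e j).val • u j) + g ∈ P := QuotientAddGroup.eq.mp he
  obtain ⟨y, hy⟩ := hP _ hmem
  refine ⟨fun j => (e j).val, y, ?_⟩
  calc g = ∑ j, (e j).val • u j + (-(∑ j, (e j).val • u j) + g) := by abel
    _ = ∑ j, (e j).val • u j + p • y := by rw [hy]

/-- (C3a), consistency check: under the same hypotheses the quotient has EXACTLY `p ^ n` elements (so a record's `hcard`,
taken from the `S`-unit rank, is confirmed by the certificate itself). -/
theorem natCard_quotient_eq_of_charMatrix (u : Fin n → M) (χ : Fin m → M →+ ZMod p)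
    (hind : ∀ e : Fin n → ZMod p, (∀ i, ∑ j, e j * χ i (u j) = 0) → e = 0)
    (P : AddSubgroup M) (hP : ∀ x ∈ P, ∃ y : M, x = p • y) [Finite (M ⧸ P)] (hcard : Nat.card (M ⧸ P) ≤ p ^ n) :
    Nat.card (M ⧸ P) = p ^ n := by
  have hinj := comparison_injective u χ hind P hP
  have hcardF : Nat.card (Fin n → ZMod p) = p ^ n := by
    classical
    rw [Nat.card_eq_fintype_card, Fintype.card_fun, ZMod.card, Fintype.card_fin]
  have hle : Nat.card (Fin n → ZMod p) ≤ Nat.card (M ⧸ P) := Nat.card_le_card_of_injective _ hinj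
  rw [hcardF] at hle
  exact le_antisymm hcard hle

end Summit.BirchSwinnertonDyer.Rank1Residual.X11b.UnitSaturationCertificate
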